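import Summits.NavierStokesRegularity.NavierStokesRegularity.Theorems.StrainDoorsGrowth
import Literature.Analysis.FluidPDE.RadialCalculus
import HarnessLib

/-!
# StrainDoorsGrowthWeighted — door family S37 «StrainDoors» (nsreg-p1 ROUND-35 v1.1), plate E1_S♭ «StrainGrowthWeighted»

S-door lane (ns-sfl-p1 g5; KEY (d) LEAD ns-s30-p1 g3 2026-08-28T18:53:38Z; texts of record nsreg-p1 g31
`r35/Sketch37b.lean` sha16 d674839b8ebfbacc, `StrainGrowthWeighted` l.317; `--supports stmt-NavierStokesRegularity-0056
--as helper`). The Riccati law at a PENALISED strain maximum (the one open plate of the almost-maximiser doors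
S37-H♭/Π♭): `x₀` a global maximum of `y ↦ (1 + ε|y|²)⁻¹⟪∇v(y)e₀, e₀⟫` with `q₀ = ⟪∇v(x₀)e₀,e₀⟫ ≥ 0`; then for every
`w` with `w + D((v·∇)v)(x₀)e₀ = νD(Δv)(x₀)e₀ − D(∇q)(x₀)e₀`:
`⟪w,e₀⟫ ≤ −q₀² + ¼(|ω|² − ⟪ω,e₀⟫²) − ⟪D(∇q)(x₀)e₀,e₀⟫ + (6νε + √ε|v(x₀)|)q₀`.

Device (no quotient calculus): with `g = 1 + ε|y|²` and `Q(y) = ⟪e₀, ∇v(y)e₀⟫`, the weighted maximum says that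
`Φ = g(x₀)·Q − q₀·g` has a global maximum (`= 0`) at `x₀`; Fermat `g(x₀)∇Q(x₀) = q₀∇g(x₀) = 2εq₀x₀` bounds the transport
term by `√ε|v(x₀)|q₀` (`2ε|x₀| ≤ √ε(1 + ε|x₀|²)`), and `ΔΦ(x₀) ≤ 0` with `Δg = 6ε` (`laplacian_comp_norm_sq`) gives
`ΔQ(x₀) ≤ 6εq₀`; the matrix term is E1_S's `neg_inner_fderiv_fderiv_le`.

WHAT THIS IS NOT: the engine of regularity CRITERIA (doors S37-H♭/Π♭); item 0056 `NoTypeII` and NS regularity are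
NOT proved; nothing here is a route or a summit statement.
-/

-- the summit's problem namespace repeats the summit name (tree layout)
set_option linter.dupNamespace false

noncomputable section

open Set Function Filter Topology InnerProductSpace
open scoped RealInnerProductSpace Laplacian ContDiff
open Literature.Analysis Literature.Analysis.FluidPDE VectorCalculus

namespace Summit.NavierStokesRegularity.NavierStokesRegularity.Theorems.ArgmaxDoors

-- nested operator types (second derivatives)
set_option maxSynthPendingDepth 3

/-- `Δ(y ↦ ⟪e, ∇v(y)e⟫)(x₀) = ⟪e, D(Δv)(x₀)e⟫` for smooth `v`. -/
theorem laplacian_inner_fderiv_apply_eq {v : EuclideanSpace ℝ (Fin 3) → EuclideanSpace ℝ (Fin 3)}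
    (hv : ContDiff ℝ ∞ v) (x₀ e : EuclideanSpace ℝ (Fin 3)) :
    Δ (fun y => ⟪e, fderiv ℝ v y e⟫) x₀ = ⟪e, fderiv ℝ (Δ v) x₀ e⟫ := by
  have hv3 : ContDiff ℝ 3 v := hv.of_le (by norm_cast)
  have hg : ContDiff ℝ 2 (fun y => fderiv ℝ v y e) :=
    ((hv.of_le (by norm_cast : (3 : WithTop ℕ∞) ≤ ∞)).fderiv_right (m := 2) (by norm_cast)).clm_apply
      contDiff_const
  rw [fderiv_laplacian_apply_of_contDiff_three hv3 x₀ e]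
  exact (hg.contDiffAt (x := x₀)).laplacian_CLM_comp_left (l := innerSL ℝ e)

/-- `y ↦ ⟪e, ∇v(y)e⟫` is `C²` for smooth `v`. -/
theorem contDiff_inner_fderiv_apply {v : EuclideanSpace ℝ (Fin 3) → EuclideanSpace ℝ (Fin 3)}
    (hv : ContDiff ℝ ∞ v) (e : EuclideanSpace ℝ (Fin 3)) : ContDiff ℝ 2 (fun y => ⟪e, fderiv ℝ v y e⟫) :=
  (innerSL ℝ e).contDiff.comp
    (((hv.of_le (by norm_cast : (3 : WithTop ℕ∞) ≤ ∞)).fderiv_right (m := 2) (by norm_cast)).clm_apply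
      contDiff_const)

/-- The derivative of `y ↦ ⟪e, ∇v(y)e⟫` at `x₀` in the direction `a` is `⟪e, D²v(x₀)(a)(e)⟫`. -/
theorem hasFDerivAt_inner_fderiv_apply {v : EuclideanSpace ℝ (Fin 3) → EuclideanSpace ℝ (Fin 3)}
    (hv : ContDiff ℝ ∞ v) (x₀ e : EuclideanSpace ℝ (Fin 3)) :
    HasFDerivAt (fun y => ⟪e, fderiv ℝ v y e⟫)
      ((innerSL ℝ e).comp (fderiv ℝ (fun y => fderiv ℝ v y e) x₀)) x₀ ∧
    ∀ a, ((innerSL ℝ e).comp (fderiv ℝ (fun y => fderiv ℝ v y e) x₀)) a =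
      ⟪e, fderiv ℝ (fderiv ℝ v) x₀ a e⟫ := by
  have hv2 : ContDiff ℝ 2 v := hv.of_le (by norm_cast)
  have hD1 : ContDiff ℝ 1 (fderiv ℝ v) := hv2.fderiv_right (m := 1) (by norm_cast)
  have hD1d : DifferentiableAt ℝ (fderiv ℝ v) x₀ := (hD1.differentiable one_ne_zero) x₀
  have hg : DifferentiableAt ℝ (fun y => fderiv ℝ v y e) x₀ := hD1d.clm_apply (differentiableAt_const e)
  refine ⟨(innerSL ℝ e).hasFDerivAt.comp x₀ hg.hasFDerivAt, fun a => ?_⟩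
  simp only [ContinuousLinearMap.coe_comp, comp_apply, innerSL_apply_apply]
  rw [fderiv_apply_const_apply hD1d e a]

/-- **Plate E1_S♭ «StrainGrowthWeighted»** (nsreg-p1 ROUND-35 v1.1, `Sketch37b.lean` l.317), PROVED — the text
δ-unfolded: the Riccati law at a penalised strain maximum, with the penalisation errors `6νε·q₀` (viscous) and
`√ε|v(x₀)|·q₀` (transport). -/
theorem strainGrowthWeighted : ∀ (ν ε : ℝ), 0 ≤ ν → 0 < ε →
    ∀ (v : (EuclideanSpace ℝ (Fin 3)) → (EuclideanSpace ℝ (Fin 3))) (q : (EuclideanSpace ℝ (Fin 3)) → ℝ),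
      ContDiff ℝ ∞ v →
      ∀ (x₀ e₀ : EuclideanSpace ℝ (Fin 3)), ‖e₀‖ = 1 →
        (∀ y : EuclideanSpace ℝ (Fin 3),
          (1 + ε * ‖y‖ ^ 2)⁻¹ * ⟪fderiv ℝ v y e₀, e₀⟫ ≤ (1 + ε * ‖x₀‖ ^ 2)⁻¹ * ⟪fderiv ℝ v x₀ e₀, e₀⟫) →
        0 ≤ ⟪fderiv ℝ v x₀ e₀, e₀⟫ →
        ∀ w : EuclideanSpace ℝ (Fin 3),
          w + fderiv ℝ (convect v v) x₀ e₀ = ν • fderiv ℝ (Δ v) x₀ e₀ - fderiv ℝ (gradient q) x₀ e₀ →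
          ⟪w, e₀⟫ ≤ -⟪fderiv ℝ v x₀ e₀, e₀⟫ ^ 2 + (1 / 4) * (‖curl v x₀‖ ^ 2 - ⟪curl v x₀, e₀⟫ ^ 2) -
            ⟪fderiv ℝ (gradient q) x₀ e₀, e₀⟫ +
            (6 * ν * ε + Real.sqrt ε * ‖v x₀‖) * ⟪fderiv ℝ v x₀ e₀, e₀⟫ := by
  intro ν ε hν hε v q hv x₀ e₀ he₀ hmax hq0 w hw
  have hv2 : ContDiff ℝ 2 v := hv.of_le (by norm_cast)
  have hvd : Differentiable ℝ v := (hv.of_le (by norm_cast : (1 : WithTop ℕ∞) ≤ ∞)).differentiable one_ne_zero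
  have hD1 : ContDiff ℝ 1 (fderiv ℝ v) := hv2.fderiv_right (m := 1) (by norm_cast)
  have hD1d : DifferentiableAt ℝ (fderiv ℝ v) x₀ := (hD1.differentiable one_ne_zero) x₀
  -- names: `q₀`, the weight `g`, the form `Q`
  obtain ⟨q₀, hq₀⟩ : ∃ q₀ : ℝ, q₀ = ⟪fderiv ℝ v x₀ e₀, e₀⟫ := ⟨_, rfl⟩
  rw [← hq₀] at hq0 ⊢
  obtain ⟨g, hg⟩ : ∃ g : EuclideanSpace ℝ (Fin 3) → ℝ, g = fun y => 1 + ε * ‖y‖ ^ 2 := ⟨_, rfl⟩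
  have hgpos : ∀ y, 0 < g y := fun y => by rw [hg]; positivity
  have hg1 : ∀ y, 1 ≤ g y := fun y => by rw [hg]; simp only; nlinarith [sq_nonneg ‖y‖, hε.le]
  obtain ⟨Q, hQ⟩ : ∃ Q : EuclideanSpace ℝ (Fin 3) → ℝ, Q = fun y => ⟪e₀, fderiv ℝ v y e₀⟫ := ⟨_, rfl⟩
  have hQx : Q x₀ = q₀ := by rw [hQ, hq₀]; exact real_inner_comm _ _
  -- the weighted maximum: `Q(y) g(x₀) ≤ q₀ g(y)`
  have hgy : ∀ y, g y = 1 + ε * ‖y‖ ^ 2 := fun y => by rw [hg]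
  have hwmax : ∀ y, Q y * g x₀ ≤ q₀ * g y := by
    intro y
    have h := hmax y
    have hQy : Q y = ⟪fderiv ℝ v y e₀, e₀⟫ := by rw [hQ]; exact real_inner_comm _ _
    have h' : Q y / g y ≤ q₀ / g x₀ := by
      rw [hgy, hgy, hQy, hq₀, div_eq_inv_mul, div_eq_inv_mul]; exact h
    exact (div_le_div_iff₀ (hgpos y) (hgpos x₀)).1 h'
  -- `Φ = g(x₀) Q − q₀ g` has a global maximum at `x₀`
  have hΦmax : IsLocalMax (fun y => g x₀ * Q y - q₀ * g y) x₀ :=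
    Filter.Eventually.of_forall fun y => by
      show g x₀ * Q y - q₀ * g y ≤ g x₀ * Q x₀ - q₀ * g x₀
      rw [hQx]; nlinarith [hwmax y]
  -- calculus of `g`
  have hγ : ∀ σ ∈ (univ : Set ℝ), HasDerivAt (fun τ : ℝ => 1 + ε * τ) ((fun _ : ℝ => ε) σ) σ := fun σ _ => by
    simpa using ((hasDerivAt_id σ).const_mul ε).const_add 1
  have hgfun : g = fun y : EuclideanSpace ℝ (Fin 3) => (fun τ : ℝ => 1 + ε * τ) (‖y‖ ^ 2) := by rw [hg]
  have hDg : HasFDerivAt g ((2 * ε) • (innerSL ℝ x₀ : EuclideanSpace ℝ (Fin 3) →L[ℝ] ℝ)) x₀ := by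
    rw [hgfun]; exact hasFDerivAt_comp_norm_sq (hγ _ (mem_univ _))
  have hΔg : Δ g x₀ = 6 * ε := by
    rw [hgfun, laplacian_comp_norm_sq (E := EuclideanSpace ℝ (Fin 3)) isOpen_univ hγ (mem_univ _)
      (hasDerivAt_const _ _), finrank_euclideanSpace_fin]
    push_cast; ring
  have hgC : ContDiff ℝ 2 g := by
    rw [hg]; exact contDiff_const.add (contDiff_const.mul (contDiff_norm_sq ℝ))
  -- calculus of `Q`
  obtain ⟨hDQ, hDQa⟩ := hasFDerivAt_inner_fderiv_apply hv x₀ e₀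
  rw [← hQ] at hDQ
  have hQC : ContDiff ℝ 2 Q := by rw [hQ]; exact contDiff_inner_fderiv_apply hv e₀
  have hΔQ : Δ Q x₀ = ⟪e₀, fderiv ℝ (Δ v) x₀ e₀⟫ := by rw [hQ]; exact laplacian_inner_fderiv_apply_eq hv x₀ e₀
  -- Fermat for `Φ`
  have hΦd : HasFDerivAt (fun y => g x₀ * Q y - q₀ * g y)
      (g x₀ • ((innerSL ℝ e₀).comp (fderiv ℝ (fun y => fderiv ℝ v y e₀) x₀)) -
        q₀ • ((2 * ε) • (innerSL ℝ x₀ : EuclideanSpace ℝ (Fin 3) →L[ℝ] ℝ))) x₀ :=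
    (hDQ.const_mul (g x₀)).sub (hDg.const_mul q₀)
  have hFermat := hΦmax.hasFDerivAt_eq_zero hΦd
  have hFa : g x₀ * ⟪e₀, fderiv ℝ (fderiv ℝ v) x₀ (v x₀) e₀⟫ = q₀ * (2 * ε * ⟪x₀, v x₀⟫) := by
    have h := congrArg (fun L : EuclideanSpace ℝ (Fin 3) →L[ℝ] ℝ => L (v x₀)) hFermat
    simp only [sub_apply, smul_apply, hDQa, innerSL_apply_apply, smul_eq_mul, zero_apply] at h
    linarith
  -- second-order condition for `Φ`
  have hΔΦ : Δ (fun y => g x₀ * Q y - q₀ * g y) x₀ ≤ 0 :=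
    IsLocalMax.laplacian_nonpos ((contDiff_const.mul hQC).sub (contDiff_const.mul hgC)) hΦmax
  have hΔΦ' : Δ (fun y => g x₀ * Q y - q₀ * g y) x₀ = g x₀ * Δ Q x₀ - q₀ * Δ g x₀ := by
    have h1 : (fun y => g x₀ * Q y - q₀ * g y) = (g x₀ • Q) - (q₀ • g) := by
      funext y; simp [smul_eq_mul]
    have hc1 : ContDiffAt ℝ 2 (g x₀ • Q) x₀ := (hQC.const_smul (g x₀)).contDiffAt
    have hc2 : ContDiffAt ℝ 2 (q₀ • g) x₀ := (hgC.const_smul q₀).contDiffAt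
    rw [h1, hc1.laplacian_sub hc2, laplacian_smul _ hQC.contDiffAt, laplacian_smul _ hgC.contDiffAt,
      smul_eq_mul, smul_eq_mul]
  rw [hΔΦ', hΔQ, hΔg] at hΔΦ
  -- (i) the viscous term: `⟪D(Δv)e₀, e₀⟫ ≤ 6ε q₀`
  have hvisc : ⟪fderiv ℝ (Δ v) x₀ e₀, e₀⟫ ≤ 6 * ε * q₀ := by
    rw [real_inner_comm]
    have h1 : g x₀ * ⟪e₀, fderiv ℝ (Δ v) x₀ e₀⟫ ≤ 6 * ε * q₀ := by linarith
    have h60 : 0 ≤ 6 * ε * q₀ := by positivity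
    by_cases hX : ⟪e₀, fderiv ℝ (Δ v) x₀ e₀⟫ ≤ 0
    · exact hX.trans h60
    · have hX' : 0 ≤ ⟪e₀, fderiv ℝ (Δ v) x₀ e₀⟫ := le_of_lt (not_le.1 hX)
      exact (le_mul_of_one_le_left hX' (hg1 x₀)).trans h1
  -- (ii) the transport term: `−⟪D²v(e₀)(v x₀), e₀⟫ ≤ √ε |v(x₀)| q₀`
  have hsymm : fderiv ℝ (fderiv ℝ v) x₀ e₀ (v x₀) = fderiv ℝ (fderiv ℝ v) x₀ (v x₀) e₀ :=
    (hv2.contDiffAt.isSymmSndFDerivAt (by simp [minSmoothness_of_isRCLikeNormedField])).eq e₀ (v x₀)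
  have htrans : -⟪fderiv ℝ (fderiv ℝ v) x₀ e₀ (v x₀), e₀⟫ ≤ Real.sqrt ε * ‖v x₀‖ * q₀ := by
    rw [hsymm, real_inner_comm]
    -- `⟪e₀, D²v(v x₀) e₀⟫ = 2ε q₀ ⟪x₀, v x₀⟫ / g(x₀)`
    have hT : ⟪e₀, fderiv ℝ (fderiv ℝ v) x₀ (v x₀) e₀⟫ = q₀ * (2 * ε * ⟪x₀, v x₀⟫) / g x₀ := by
      rw [eq_div_iff (hgpos x₀).ne', mul_comm, hFa]
    rw [hT]
    have hsε : 0 < Real.sqrt ε := Real.sqrt_pos.2 hε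
    have hε2 : Real.sqrt ε ^ 2 = ε := Real.sq_sqrt hε.le
    -- `2ε|⟪x₀, v x₀⟫| ≤ √ε (1 + ε|x₀|²) |v x₀|`
    have hin : |⟪x₀, v x₀⟫| ≤ ‖x₀‖ * ‖v x₀‖ := abs_real_inner_le_norm _ _
    have hamgm : 2 * ε * ‖x₀‖ ≤ Real.sqrt ε * (1 + ε * ‖x₀‖ ^ 2) := by
      nlinarith [sq_nonneg (Real.sqrt ε * ‖x₀‖ - 1), hε2, hsε, norm_nonneg x₀]
    have hG : 0 < 1 + ε * ‖x₀‖ ^ 2 := by positivity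
    have h3 : -(q₀ * (2 * ε * ⟪x₀, v x₀⟫)) ≤ q₀ * (2 * ε * (‖x₀‖ * ‖v x₀‖)) := by
      have h6 := mul_le_mul_of_nonneg_left (abs_le.1 hin).1 (by positivity : (0 : ℝ) ≤ q₀ * (2 * ε))
      linarith [h6]
    have h4 : q₀ * (2 * ε * (‖x₀‖ * ‖v x₀‖)) ≤ Real.sqrt ε * ‖v x₀‖ * q₀ * (1 + ε * ‖x₀‖ ^ 2) := by
      have := mul_le_mul_of_nonneg_right hamgm (mul_nonneg (norm_nonneg (v x₀)) hq0)
      nlinarith [this]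
    have h5 : -(q₀ * (2 * ε * ⟪x₀, v x₀⟫) / g x₀) = (-(q₀ * (2 * ε * ⟪x₀, v x₀⟫))) / g x₀ := by ring
    rw [h5, div_le_iff₀ (hgpos x₀), hgy x₀]
    linarith
  -- the product rule for the convective term, solve for `w`
  have hconv : convect v v = fun y => fderiv ℝ v y (v y) := rfl
  have hprod : fderiv ℝ (convect v v) x₀ e₀ =
      fderiv ℝ (fderiv ℝ v) x₀ e₀ (v x₀) + fderiv ℝ v x₀ (fderiv ℝ v x₀ e₀) := by
    rw [hconv, fderiv_clm_apply hD1d (hvd x₀)]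
    simp only [add_apply, ContinuousLinearMap.coe_comp, comp_apply, ContinuousLinearMap.flip_apply]
    rw [add_comm]
  have hw' : w = ν • fderiv ℝ (Δ v) x₀ e₀ - fderiv ℝ (gradient q) x₀ e₀ -
      (fderiv ℝ (fderiv ℝ v) x₀ e₀ (v x₀) + fderiv ℝ v x₀ (fderiv ℝ v x₀ e₀)) := by
    rw [← hprod, ← hw]; abel
  rw [hw', inner_sub_left, inner_sub_left, inner_add_left, real_inner_smul_left]
  have hmat := neg_inner_fderiv_fderiv_le v x₀ e₀ he₀
  rw [← hq₀] at hmat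
  have h5 : ν * ⟪fderiv ℝ (Δ v) x₀ e₀, e₀⟫ ≤ ν * (6 * ε * q₀) := mul_le_mul_of_nonneg_left hvisc hν
  nlinarith [h5, htrans, hmat]

end Summit.NavierStokesRegularity.NavierStokesRegularity.Theorems.ArgmaxDoors

end
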